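import Mathlib
import Literature.NumberTheory.Transcendental.LinEDS
import Literature.NumberTheory.Transcendental.LinEDSCode
import Literature.NumberTheory.Transcendental.LinEDSCompact
import Summits.KontsevichZagierPeriods.KontsevichZagierPeriods.Theorems.FurushoPentagonKernelModuloPeriodConjectureLeafOfCheckBlocksG
import Summits.KontsevichZagierPeriods.KontsevichZagierPeriods.Theorems.FurushoPentagonKernelModuloPeriodConjectureXorFoldTestBit
import HarnessLib

/-!
# `KernelModuloPeriodConjecture`, line `Sketch`: the leaf from a chain of grouped, COMPACTED block certificates

Crux `FurushoPentagon.KernelModuloPeriodConjecture` (stmt-KontsevichZagierPeriods-15058), line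
`Sketch`, lead c6. Block master theorem of the GF(2) rank engine for block certificates with
grouped rows AND compacted slots (`LinEDS.checkBlockGC`,
`Literature/NumberTheory/Transcendental/LinEDSCompact.lean`): the certificate lists the block's
columns `L` in increasing order of residue mod a width `W'` on which `c ↦ c % W'` is injective,
and the elimination runs on the group rows XOR-folded into width `W'` (`LinEDS.xorFold`), i.e. on
the same `𝔽₂`-matrix with relabelled columns — so the cost of one kernel run drops from
`n² · 2^(k-1)` to `n² · W'` (weight 16: `W' = 12287` for every depth block instead of `32768`; the
largest block, depth 8 with `3431` columns, timed out at `2^15`). The proof is the grouped block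
master `stub_leaf_of_checkBlocksG` with three changes: the pivots come from E6 at width `W'` on
the folded rows, the parity link passes through the compaction lemma `stub_xorFold_testBit`
(bit `c % W'` of the fold = bit `c` of the row, by injectivity of the residues on the block's
columns — which follow from `incMod` on `L` and `L` being a permutation of the block), and the
columns of the odd square matrix are indexed through `L`.

References: K. Ihara, M. Kaneko, D. Zagier, Compos. Math. 142 (2006) §2, Conjecture 1
[IharaKanekoZagier2006]; F. Brown, Ann. of Math. 175 (2012) Thm 1.1 [Brown2012].
-/

namespace Summit.KontsevichZagierPeriods.FurushoPentagon.KernelModuloPeriodConjecture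

open Literature.NumberTheory.Transcendental
open Literature.NumberTheory.Transcendental.LinEDS

/-! ### The unpacked compacted check and its column list -/

/-- Unpacking a successful `checkBlockGC`. [folklore] -/
theorem blocksGC_checkBlockGC {k lo D W' f : ℕ} {L : List ℕ} {groups : List (List (List ℕ × List ℕ))}
    (h : LinEDS.checkBlockGC k lo D W' f L groups = true) :
    groups.length = (LinEDS.colsDepth k lo D).length ∧ L.length = (LinEDS.colsDepth k lo D).length ∧
      (∀ c ∈ L, (LinEDS.maskOf (LinEDS.colsDepth k lo D)).testBit c = true) ∧
      LinEDS.incMod W' L = true ∧ (LinEDS.colsDepth k lo D).length < W' ∧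
      (∀ g ∈ groups, ∀ μ ∈ g, LinEDS.validName k μ = true) ∧
      (∀ g ∈ groups, LinEDS.rowBitsG k g &&& LinEDS.maskOf (LinEDS.colsDepth k D k) = 0) ∧
      LinEDS.elimLoop W' (LinEDS.rep W' groups.length) (L.map (· % W'))
        (LinEDS.pack W' ((groups.map (LinEDS.rowBitsG k)).map fun r =>
          LinEDS.xorFold W' f (r &&& LinEDS.maskOf (LinEDS.colsDepth k lo D)))) = true := by
  simp only [LinEDS.checkBlockGC, Bool.and_eq_true, List.all_eq_true, List.mem_map,
    forall_exists_index, and_imp, forall_apply_eq_imp_iff₂, beq_iff_eq, Nat.blt_eq] at h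
  obtain ⟨⟨⟨⟨⟨⟨⟨hlen, hlenL⟩, hLmask⟩, hinc⟩, hlt⟩, hval⟩, hno⟩, helim⟩ := h
  rw [sameLength_eq_true_iff] at hlen hlenL
  rw [LinEDS.lengthTR_eq] at helim hlt
  exact ⟨hlen, hlenL, hLmask, hinc, hlt, hval, hno, helim⟩

/-- The certificate's column list is a permutation of the block's columns: every block column
occurs in it (pigeonhole: `L ⊆ C`, `L` has distinct residues hence is duplicate-free, same
length, `C` duplicate-free). [folklore] -/
theorem blocksGC_mem_L {k lo D W' : ℕ} (hk : 2 ≤ k) {L : List ℕ}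
    (hLmask : ∀ c ∈ L, (LinEDS.maskOf (LinEDS.colsDepth k lo D)).testBit c = true)
    (hinc : LinEDS.incMod W' L = true) (hlenL : L.length = (LinEDS.colsDepth k lo D).length) :
    (∀ c, c ∈ L ↔ c ∈ LinEDS.colsDepth k lo D) ∧ (L.map (· % W')).Pairwise (· < ·) := by
  classical
  set C := LinEDS.colsDepth k lo D with hC
  have hpwL : (L.map (· % W')).Pairwise (· < ·) :=
    ((LinEDS.incMod_eq_true_iff L).mp hinc).pairwise
  have hndL : L.Nodup := by
    have : (L.map (· % W')).Nodup := hpwL.imp fun {a b} (h : a < b) => ne_of_lt h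
    exact this.of_map _
  obtain ⟨hpw, -, -, -⟩ := stub_cols_spec k hk
  have hCpw : C.Pairwise (· < ·) := by rw [hC, LinEDS.colsDepth]; exact hpw.filter _
  have hndC : C.Nodup := hCpw.imp fun {a b} (h : a < b) => ne_of_lt h
  have hsub : L.toFinset ⊆ C.toFinset := fun c hc =>
    List.mem_toFinset.mpr ((blocksE13_testBit_maskOf C c).mp (hLmask c (List.mem_toFinset.mp hc)))
  have heq : L.toFinset = C.toFinset :=
    Finset.eq_of_subset_of_card_le hsub (by
      rw [List.toFinset_card_of_nodup hndL, List.toFinset_card_of_nodup hndC, hlenL])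
  refine ⟨fun c => ?_, hpwL⟩
  rw [← List.mem_toFinset, heq, List.mem_toFinset]

/-! ### One block: its diagonal integer block has odd determinant -/

/-- **The diagonal block of a grouped, compacted certificate is odd**: the integer matrix of its
groups against the columns listed by the certificate has odd determinant (E6 at width `W'` on the
folded rows, the compaction lemma, group parities, E7 (a)). [cite: IharaKanekoZagier2006, §2] -/
theorem blocksGC_diag_odd {k lo D W' f : ℕ} (hk : 2 ≤ k) {L : List ℕ}
    {groups : List (List (List ℕ × List ℕ))}
    (h : LinEDS.checkBlockGC k lo D W' f L groups = true) (hfuel : 2 ^ (k - 1) ≤ W' * (f + 1))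
    (hlen : (LinEDS.colsDepth k lo D).length = groups.length)
    (hlenL : (LinEDS.colsDepth k lo D).length = L.length) :
    Odd (Matrix.of fun (x y : Fin (LinEDS.colsDepth k lo D).length) =>
      LinEDS.entryG k (groups.get (Fin.cast hlen x)) (L.get (Fin.cast hlenL y))).det := by
  classical
  obtain ⟨-, hlenL', hLmask, hinc, hlt, hval, -, helim⟩ := blocksGC_checkBlockGC h
  obtain ⟨hmemL, hpwL⟩ := blocksGC_mem_L hk hLmask hinc hlenL'
  obtain ⟨hpw, hcols, -, -⟩ := stub_cols_spec k hk
  set C := LinEDS.colsDepth k lo D with hC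
  set mask := LinEDS.maskOf C with hmask
  have hCsub : ∀ c ∈ C, c ∈ LinEDS.cols k := fun c hc => (blocksE13_mem_colsDepth.mp hc).1
  have hW : 0 < W' := by omega
  -- the folded rows and E6 at width W'
  set rows := (groups.map (LinEDS.rowBitsG k)).map fun r => LinEDS.xorFold W' f (r &&& mask) with hrows
  have hrowlt : ∀ r ∈ rows, r < 2 ^ W' := by
    intro r hr
    obtain ⟨r', -, rfl⟩ := List.mem_map.mp hr
    exact LinEDS.xorFold_lt f _
  have hrowslen : rows.length = groups.length := by simp [hrows]
  have hcolslt : ∀ c ∈ L.map (· % W'), c < W' := by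
    intro c hc
    obtain ⟨c', -, rfl⟩ := List.mem_map.mp hc
    exact Nat.mod_lt _ hW
  have hpiv := stub_elimLoop_sound W' rows (L.map (· % W')) hW hrowlt hcolslt
    (by rw [hrowslen]; exact helim)
  -- E7 (a): rows indexed by the groups, columns by the residues of L
  let row : Fin C.length → ℕ := fun x =>
    LinEDS.xorFold W' f (LinEDS.rowBitsG k (groups.get (Fin.cast hlen x)) &&& mask)
  have hofFn : List.ofFn row = rows := by
    rw [hrows, List.map_map]
    exact blocksE13_ofFn_get groups ((fun r => LinEDS.xorFold W' f (r &&& mask)) ∘ LinEDS.rowBitsG k) hlen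
  let col : Fin C.length → ℕ := fun y => L.get (Fin.cast hlenL y) % W'
  have hcolget : ∀ y, col y = (L.map (· % W')).get (Fin.cast (by simp [hlenL]) y) := fun y => by
    simp [col]
  have hmono : StrictMono col := by
    intro x y hxy
    rw [hcolget, hcolget]
    exact List.pairwise_iff_get.mp hpwL _ _ hxy
  refine stub_oddDet_and_solve.1 C.length row col hmono
    (fun y => hofFn ▸ hpiv (col y) (by rw [hcolget]; exact List.get_mem _ _)) _ fun x y => ?_
  -- parities: entry parity = bit of the group row at the column = bit of the folded row at the residue
  have hyL : L.get (Fin.cast hlenL y) ∈ L := List.get_mem _ _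
  have hyC : L.get (Fin.cast hlenL y) ∈ C := (hmemL _).mp hyL
  rw [Matrix.of_apply, ← blocksG_rowBitsG_parity (hval _ (List.get_mem _ _)) (hCsub _ hyC)]
  show _ ↔ (LinEDS.xorFold W' f (LinEDS.rowBitsG k (groups.get (Fin.cast hlen x)) &&& mask)).testBit
    (L.get (Fin.cast hlenL y) % W') = true
  -- support of the masked row lies in L; residues injective on L
  have hsupp : ∀ i, (LinEDS.rowBitsG k (groups.get (Fin.cast hlen x)) &&& mask).testBit i = true → i ∈ L := by
    intro i hi
    rw [Nat.testBit_land, Bool.and_eq_true] at hi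
    exact (hmemL i).mpr ((blocksE13_testBit_maskOf C i).mp hi.2)
  have hinj : ∀ a ∈ L, ∀ b ∈ L, a % W' = b % W' → a = b :=
    List.inj_on_of_nodup_map (hpwL.imp fun {a b} (h : a < b) => ne_of_lt h)
  have hmasklt : mask < 2 ^ 2 ^ (k - 1) := by
    refine Nat.lt_pow_two_of_testBit _ fun i hi => ?_
    cases hb : mask.testBit i
    · rfl
    · have := ((hcols i).mp (hCsub i ((blocksE13_testBit_maskOf C i).mp hb))).1; omega
  have hsize : LinEDS.rowBitsG k (groups.get (Fin.cast hlen x)) &&& mask < 2 ^ (W' * (f + 1)) :=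
    lt_of_lt_of_le (lt_of_le_of_lt Nat.and_le_right hmasklt) (Nat.pow_le_pow_right (by norm_num) hfuel)
  rw [stub_xorFold_testBit W' f _ _ L hW hsize hsupp hyL hinj, Nat.testBit_land,
    (blocksE13_testBit_maskOf C _).mpr hyC, Bool.and_true]

/-! ### The registered stub -/

/-- **The leaf from a chain of grouped, compacted block certificates** (registered stub
`stub_leaf_of_checkBlocksGC`, lead c6; crux stmt-KontsevichZagierPeriods-15058, line `Sketch`):
consecutive depth blocks `(0, D₁], (D₁, D₂], …` covering every column, each certified by
`LinEDS.checkBlockGC` at some width `W'` with enough fuel (`2^(k-1) ≤ W'(f+1)`, so the fold is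
complete) ⇒ the weight-`k` slice of the algebraic leaf. [cite: IharaKanekoZagier2006, Conjecture 1] -/
theorem stub_leaf_of_checkBlocksGC :
    ∀ (k : ℕ) (bl : List (ℕ × ℕ)), 2 ≤ k → bl ≠ [] → (∀ p ∈ bl, p.1 ≤ p.2) →
      bl.head?.map Prod.fst = some 0 → bl.IsChain (fun p q => p.2 = q.1) →
      (∀ p ∈ bl, ∃ (W' f : ℕ) (L : List ℕ) (groups : List (List (List ℕ × List ℕ))),
        2 ^ (k - 1) ≤ W' * (f + 1) ∧ LinEDS.checkBlockGC k p.1 p.2 W' f L groups = true) →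
      LinEDS.depthCovered k ((bl.getLast?.map Prod.snd).getD 0) = true →
      ∀ s : List ℕ, MZV.IsAdmissible s → MZV.weight s = k →
        ∃ b : List ℕ →₀ ℚ, (∀ t ∈ b.support, MZV.IsHoffman t ∧ MZV.weight t = MZV.weight s) ∧ ∀ (R : Type) [CommRing R] [Algebra ℚ R] [IsReduced R] (φ : NCSeries Bool R), NCSeries.IsGroupLike φ → NCSeries.DrinfeldPentagon φ → φ (MZV.binaryWord s) = b.sum (fun t q => q • φ (MZV.binaryWord t)) := by
  classical
  intro k bl hk hne hle hhead hchain hblocks hcov s hs hw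
  choose Wq fq Lq nm hfuel hnm using hblocks
  set B := bl.length with hB
  let lo : Fin B → ℕ := fun β => (bl.get β).1
  let Dp : Fin B → ℕ := fun β => (bl.get β).2
  have hmemβ : ∀ β : Fin B, bl.get β ∈ bl := fun β => List.get_mem _ _
  let W' : Fin B → ℕ := fun β => Wq (bl.get β) (hmemβ β)
  let fu : Fin B → ℕ := fun β => fq (bl.get β) (hmemβ β)
  let L : Fin B → List ℕ := fun β => Lq (bl.get β) (hmemβ β)
  let groups : Fin B → List (List (List ℕ × List ℕ)) := fun β => nm (bl.get β) (hmemβ β)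
  have hchk : ∀ β, LinEDS.checkBlockGC k (lo β) (Dp β) (W' β) (fu β) (L β) (groups β) = true :=
    fun β => hnm _ _
  have hfu : ∀ β, 2 ^ (k - 1) ≤ W' β * (fu β + 1) := fun β => hfuel _ _
  let C : Fin B → List ℕ := fun β => LinEDS.colsDepth k (lo β) (Dp β)
  let nb : Fin B → ℕ := fun β => (C β).length
  have hlen : ∀ β, (C β).length = (groups β).length := fun β => ((blocksGC_checkBlockGC (hchk β)).1).symm
  have hlenL : ∀ β, (C β).length = (L β).length := fun β => ((blocksGC_checkBlockGC (hchk β)).2.1).symm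
  have hmemL : ∀ β, ∀ c, c ∈ L β ↔ c ∈ C β := fun β =>
    (blocksGC_mem_L hk (blocksGC_checkBlockGC (hchk β)).2.2.1 (blocksGC_checkBlockGC (hchk β)).2.2.2.1
      (hlenL β).symm).1
  -- positions, groups and columns (columns through the certificate's lists)
  let ν : (Σ β : Fin B, Fin (nb β)) → List (List ℕ × List ℕ) :=
    fun i => (groups i.1).get (Fin.cast (hlen i.1) i.2)
  let col : (Σ β : Fin B, Fin (nb β)) → ℕ := fun j => (L j.1).get (Fin.cast (hlenL j.1) j.2)
  have hvalid : ∀ i, ∀ μ ∈ ν i, LinEDS.validName k μ = true :=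
    fun i => (blocksGC_checkBlockGC (hchk i.1)).2.2.2.2.2.1 _ (List.get_mem _ _)
  have hcolC : ∀ j, col j ∈ C j.1 := fun j => (hmemL j.1 _).mp (List.get_mem _ _)
  have hcolmem : ∀ j, col j ∈ LinEDS.cols k := fun j => (blocksE13_mem_colsDepth.mp (hcolC j)).1
  obtain ⟨-, hcols, -, -⟩ := stub_cols_spec k hk
  -- every column lies in a block
  have hhead' : (bl.head hne).1 = 0 := by
    rw [List.head?_eq_some_head hne] at hhead
    simpa using hhead
  have hlast' : (bl.getLast?.map Prod.snd).getD 0 = (bl.getLast hne).2 := by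
    rw [List.getLast?_eq_some_getLast hne]; rfl
  rw [hlast'] at hcov
  have hcolsurj : ∀ c ∈ LinEDS.cols k, ∃ j, col j = c := by
    intro c hc
    have hd1 : 1 ≤ LinEDS.popc k c := blocksE13_popc_pos (by omega) ((hcols c).mp hc).2.1
    have hd2 : LinEDS.popc k c ≤ (bl.getLast hne).2 := by
      simp only [LinEDS.depthCovered, List.all_eq_true, Nat.ble_eq] at hcov
      exact hcov c hc
    obtain ⟨β, h1, h2⟩ := blocksE13_chain_cover bl hne hchain (LinEDS.popc k c) (by omega) hd2
    have hcC : c ∈ C β := blocksE13_mem_colsDepth.mpr ⟨hc, h1, h2⟩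
    obtain ⟨y, hy⟩ := List.mem_iff_get.mp ((hmemL β c).mpr hcC)
    exact ⟨⟨β, Fin.cast (hlenL β).symm y⟩, by simpa [col] using hy⟩
  -- odd determinant, by blocks
  have hdet : Odd (Matrix.of fun i j => LinEDS.entryG k (ν i) (col j)).det := by
    refine stub_blockDet_odd B nb _ (fun i j hij => ?_) (fun β => ?_)
    · -- above the diagonal blocks the bit vanishes, so the group entry is even
      rw [Matrix.of_apply, ← Int.not_odd_iff_even,
        ← blocksG_rowBitsG_parity (hvalid i) (hcolmem j)]
      have hdepth : Dp i.1 < LinEDS.popc k (col j) :=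
        lt_of_le_of_lt (blocksE13_chain_mono bl hchain hle i.1 j.1 hij)
          (blocksE13_mem_colsDepth.mp (hcolC j)).2.1
      have hhigher : col j ∈ LinEDS.colsDepth k (Dp i.1) k :=
        blocksE13_mem_colsDepth.mpr ⟨hcolmem j, hdepth, blocksE13_popc_le _ _⟩
      have hzero := (blocksGC_checkBlockGC (hchk i.1)).2.2.2.2.2.2.1 _
        (List.get_mem _ (Fin.cast (hlen i.1) i.2))
      have hbit := congrArg (·.testBit (col j)) hzero
      simp only [Nat.testBit_land, Nat.zero_testBit,
        (blocksE13_testBit_maskOf _ _).mpr hhigher, Bool.and_true] at hbit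
      show ¬ (LinEDS.rowBitsG k (ν i)).testBit (col j) = true
      rw [hbit]; exact Bool.false_ne_true
    · exact blocksGC_diag_odd hk (hchk β) (hfu β) (hlen β) (hlenL β)
  exact stub_leaf_of_oddDetSum k _ ν col hk hvalid hcolmem hcolsurj hdet s hs hw

end Summit.KontsevichZagierPeriods.FurushoPentagon.KernelModuloPeriodConjecture
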